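import Literature.NumberTheory.EllipticCurves.HalfIntegralWeightGaussSums
import Literature.NumberTheory.LFunctions.KloostermanWeilReduction
import HarnessLib

/-!
# Quadratic Gauss sums to odd moduli: `G(a; n) = (a/n) G(1; n)`

Sequel of `HalfIntegralWeightGaussSums` (`quadGaussSum c a k = G(a, k; c) = ∑_{r mod c} e((a r² + k r)/c)`).
We PROVE the classical evaluation of `G(a; n) = G(a, 0; n)` relative to `G(1; n)` for odd `n`:

* `quadGaussSum_mul_of_coprime` — **multiplicativity in the modulus**: for coprime `c₁, c₂`,
  `G(a; c₁c₂) = G(c₂ a; c₁) G(c₁ a; c₂)` (Chinese remainder theorem; the splitting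
  `e(y/(c₁c₂)) = e(c̄₂ y/c₁) e(c̄₁ y/c₂)` is `Literature.NumberTheory.LFunctions.stdAddChar_eq_mul_of_coprime`).
* `quadGaussSum_prime_eq` — for an odd prime `p ∤ a`, `G(a; p) = (a/p) G(1; p)` (count the square
  roots: `∑_x ψ(a x²) = ∑_t (1 + χ(t)) ψ(a t)`, Mathlib `quadraticChar_card_sqrts`, `gaussSum_mulShift`);
  `quadGaussSum_prime_one_sq` — `G(1; p)² = χ₄(p) p` (Mathlib `gaussSum_sq`).
* `quadGaussSum_prime_pow_add_two` — `G(a; p^{e+2}) = p G(a; p^e)` for an odd prime `p ∤ a`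
  (write `r = s + p^{e+1} t`; the sum over `t` detects `p ∣ s`).
* `quadGaussSum_eq_jacobiSym_mul` — **`G(a; n) = (a/n) G(1; n)`** for odd `n` and `gcd(a, n) = 1`,
  with the Jacobi symbol `J(a | n)` (induction over the coprime factorisation,
  `Nat.recOnPosPrimePosCoprime`); in particular `G(2a; n) = (2/n) G(a; n)`
  (`quadGaussSum_two_mul_left`), the input for `θ(2γz)` in the sequel.

No sign of `G(1; n)` is determined here (that is Gauss's theorem and is not needed for the theta
multiplier relations). The prime case with `k ≠ 0`, `|G(a, k; p)| = √p`, is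
`Literature.NumberTheory.LFunctions.norm_quadGaussSum` (`KloostermanSalie`).

## References

* H. Iwaniec, E. Kowalski, *Analytic Number Theory* (2004), §3.4–3.5 (quadratic Gauss sums).
* N. Koblitz, *Introduction to Elliptic Curves and Modular Forms*, GTM 97 (1993), Ch. IV §1.
-/

noncomputable section

open Complex Finset

namespace Literature.NumberTheory.EllipticCurves.ModularForms

open Literature.NumberTheory.LFunctions (sum_zmod_eq_sum_range sum_range_mul_eq_sum_sum
  stdAddChar_natCast norm_stdAddChar stdAddChar_eq_mul_of_coprime)

/-! ### Multiplicativity in the modulus -/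

/-- **`G(a; c₁c₂) = G(c₂ a; c₁) G(c₁ a; c₂)` for coprime `c₁, c₂`** (Chinese remainder theorem:
`e(y/(c₁c₂)) = e(c̄₂ y/c₁) e(c̄₁ y/c₂)` and `G(c̄₂ a; c₁) = G(c₂ a; c₁)` as `c̄₂ = c̄₂² c₂`).
[folklore] -/
theorem quadGaussSum_mul_of_coprime {c₁ c₂ : ℕ} [NeZero c₁] [NeZero c₂] [NeZero (c₁ * c₂)]
    (h : c₁.Coprime c₂) (a : ℤ) :
    quadGaussSum (c₁ * c₂) a 0 =
      quadGaussSum c₁ ((c₂ * a : ℤ) : ZMod c₁) 0 * quadGaussSum c₂ ((c₁ * a : ℤ) : ZMod c₂) 0 := by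
  classical
  set E := ZMod.chineseRemainder h with hE
  have hE1 : ∀ x, (E x).1 = ZMod.castHom (dvd_mul_right c₁ c₂) (ZMod c₁) x :=
    fun x ↦ Prod.fst_zmod_cast x
  have hE2 : ∀ x, (E x).2 = ZMod.castHom (dvd_mul_left c₂ c₁) (ZMod c₂) x :=
    fun x ↦ Prod.snd_zmod_cast x
  set e₂ : ZMod c₁ := (c₂ : ZMod c₁)⁻¹ with he₂'
  set e₁ : ZMod c₂ := (c₁ : ZMod c₂)⁻¹ with he₁'
  have he₂ : (c₂ : ZMod c₁) * e₂ = 1 := ZMod.coe_mul_inv_eq_one c₂ h.symm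
  have he₁ : (c₁ : ZMod c₂) * e₁ = 1 := ZMod.coe_mul_inv_eq_one c₁ h
  have hu₂ : IsUnit e₂ := IsUnit.of_mul_eq_one (c₂ : ZMod c₁) (by rw [mul_comm]; exact he₂)
  have hu₁ : IsUnit e₁ := IsUnit.of_mul_eq_one (c₁ : ZMod c₂) (by rw [mul_comm]; exact he₁)
  -- Step 1: split the character and reindex by the Chinese remainder theorem
  have key : quadGaussSum (c₁ * c₂) a 0 =
      quadGaussSum c₁ (e₂ * (a : ZMod c₁)) 0 * quadGaussSum c₂ (e₁ * (a : ZMod c₂)) 0 := by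
    rw [quadGaussSum_def, quadGaussSum_def, quadGaussSum_def, Finset.sum_mul_sum,
      ← Fintype.sum_prod_type']
    refine Fintype.sum_bijective E E.bijective _ _ fun x ↦ ?_
    have h1 : ZMod.castHom (dvd_mul_right c₁ c₂) (ZMod c₁) ((a : ZMod (c₁ * c₂)) * x ^ 2) =
        (a : ZMod c₁) * (E x).1 ^ 2 := by
      rw [map_mul, map_pow, map_intCast, hE1]
    have h2 : ZMod.castHom (dvd_mul_left c₂ c₁) (ZMod c₂) ((a : ZMod (c₁ * c₂)) * x ^ 2) =
        (a : ZMod c₂) * (E x).2 ^ 2 := by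
      rw [map_mul, map_pow, map_intCast, hE2]
    rw [zero_mul, add_zero, zero_mul, add_zero, zero_mul, add_zero,
      stdAddChar_eq_mul_of_coprime h, h1, h2, ← he₂', ← he₁']
    ring_nf
  -- Step 2: `G(c̄₂ a; c₁) = G(c₂ a; c₁)`
  rw [key]
  congr 1
  · have : e₂ * (a : ZMod c₁) = e₂ ^ 2 * ((c₂ * a : ℤ) : ZMod c₁) := by
      push_cast
      linear_combination (-(e₂ * (a : ZMod c₁))) * he₂
    rw [this, quadGaussSum_unit_sq_mul hu₂]
  · have : e₁ * (a : ZMod c₂) = e₁ ^ 2 * ((c₁ * a : ℤ) : ZMod c₂) := by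
      push_cast
      linear_combination (-(e₁ * (a : ZMod c₂))) * he₁
    rw [this, quadGaussSum_unit_sq_mul hu₁]

/-! ### Odd primes -/

section Prime

variable {p : ℕ} [hp : Fact p.Prime]

/-- Summing a function of `x²` over `ℤ/p`: `∑_x f(x²) = ∑_t #{x | x² = t} f(t)`. [folklore] -/
theorem sum_sq_eq_sum_card_mul (f : ZMod p → ℂ) :
    ∑ x : ZMod p, f (x ^ 2) = ∑ t : ZMod p, ({x : ZMod p | x ^ 2 = t}.toFinset.card : ℂ) * f t := by
  classical
  calc ∑ x : ZMod p, f (x ^ 2)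
      = ∑ x : ZMod p, ∑ t : ZMod p, if x ^ 2 = t then f t else 0 := by
        refine Finset.sum_congr rfl fun x _ ↦ ?_
        rw [Finset.sum_ite_eq Finset.univ (x ^ 2) f, if_pos (Finset.mem_univ _)]
    _ = ∑ t : ZMod p, ∑ x : ZMod p, if x ^ 2 = t then f t else 0 := Finset.sum_comm
    _ = ∑ t : ZMod p, ({x : ZMod p | x ^ 2 = t}.toFinset.card : ℂ) * f t := by
        refine Finset.sum_congr rfl fun t _ ↦ ?_
        rw [← Finset.sum_filter, Finset.sum_const, nsmul_eq_mul, Set.toFinset_setOf]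

/-- For an odd prime `p` and `b ≢ 0`: `∑_x e(b x²/p) = χ(b) · g`, `χ` the (complex-valued)
quadratic character, `g = gaussSum χ e(·/p)`. [folklore] -/
theorem quadGaussSum_prime_eq_quadraticChar_mul (hp2 : p ≠ 2) {b : ZMod p} (hb : b ≠ 0) :
    quadGaussSum p b 0 =
      (quadraticChar (ZMod p)).ringHomComp (Int.castRingHom ℂ) b *
        gaussSum ((quadraticChar (ZMod p)).ringHomComp (Int.castRingHom ℂ))
          (ZMod.stdAddChar (N := p)) := by
  classical
  set χ := (quadraticChar (ZMod p)).ringHomComp (Int.castRingHom ℂ) with hχ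
  have hF : ringChar (ZMod p) ≠ 2 := by rwa [ZMod.ringChar_zmod_n]
  rw [quadGaussSum_def]
  simp_rw [zero_mul, add_zero]
  rw [sum_sq_eq_sum_card_mul (fun t ↦ (ZMod.stdAddChar (b * t) : ℂ))]
  have hcard : ∀ t : ZMod p, ({x : ZMod p | x ^ 2 = t}.toFinset.card : ℂ) = χ t + 1 := by
    intro t
    have := quadraticChar_card_sqrts hF t
    rw [hχ, MulChar.ringHomComp_apply, eq_intCast]
    exact_mod_cast congrArg (Int.cast : ℤ → ℂ) this
  simp_rw [hcard, add_mul, one_mul, Finset.sum_add_distrib]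
  have h0 : ∑ t : ZMod p, (ZMod.stdAddChar (b * t) : ℂ) = 0 := by
    have := AddChar.sum_mulShift b (ZMod.isPrimitive_stdAddChar p) (R' := ℂ)
    simp_rw [mul_comm _ b] at this
    rw [this, if_neg hb, Nat.cast_zero]
  rw [h0, add_zero]
  have hg := gaussSum_mulShift_eq χ (ZMod.stdAddChar (N := p)) (Units.mk0 b hb)
  rw [((quadraticChar_isQuadratic (ZMod p)).comp _).inv, Units.val_mk0, ← hχ] at hg
  rw [← hg, gaussSum]
  refine Finset.sum_congr rfl fun t _ ↦ ?_
  rw [AddChar.mulShift_apply]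

/-- `G(a; n) = (a/p) G(1; n)` for `n = p` an odd prime, `p ∤ a` (Legendre symbol); stated for any
modulus `n` equal to `p` to ease rewriting under `p = p ^ 1`. [folklore] -/
theorem quadGaussSum_prime_eq' {n : ℕ} [NeZero n] (hn : n = p) (hp2 : p ≠ 2) {a : ℤ}
    (ha : (a : ZMod p) ≠ 0) : quadGaussSum n a 0 = legendreSym p a * quadGaussSum n 1 0 := by
  subst hn
  rw [quadGaussSum_prime_eq_quadraticChar_mul hp2 ha,
    quadGaussSum_prime_eq_quadraticChar_mul hp2 one_ne_zero, map_one, one_mul,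
    MulChar.ringHomComp_apply, eq_intCast]
  rfl

/-- **`G(a; p) = (a/p) G(1; p)` for an odd prime `p ∤ a`** (Legendre symbol). [folklore] -/
theorem quadGaussSum_prime_eq (hp2 : p ≠ 2) {a : ℤ} (ha : (a : ZMod p) ≠ 0) :
    quadGaussSum p a 0 = legendreSym p a * quadGaussSum p 1 0 :=
  quadGaussSum_prime_eq' rfl hp2 ha

/-- **`G(1; p)² = χ₄(p) p`** for an odd prime `p` (Mathlib `gaussSum_sq` and
`quadraticChar_neg_one`). [folklore] -/
theorem quadGaussSum_prime_one_sq (hp2 : p ≠ 2) :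
    quadGaussSum p 1 0 ^ 2 = ZMod.χ₄ p * p := by
  classical
  have hF : ringChar (ZMod p) ≠ 2 := by rwa [ZMod.ringChar_zmod_n]
  have hne : (quadraticChar (ZMod p)).ringHomComp (Int.castRingHom ℂ) ≠ 1 :=
    (MulChar.ringHomComp_ne_one_iff (RingHom.injective_int _)).mpr (quadraticChar_ne_one hF)
  rw [quadGaussSum_prime_eq_quadraticChar_mul hp2 one_ne_zero, map_one, one_mul,
    gaussSum_sq hne ((quadraticChar_isQuadratic (ZMod p)).comp _)
      (ZMod.isPrimitive_stdAddChar p), MulChar.ringHomComp_apply, quadraticChar_neg_one hF,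
      ZMod.card, eq_intCast]

end Prime

/-! ### Prime powers -/

/-- Orthogonality: `∑_{t < N} e(x t/N) = N` if `N ∣ x`, and `0` otherwise. [folklore] -/
theorem sum_range_cexp_mul_div (N : ℕ) [NeZero N] (x : ℤ) :
    ∑ t ∈ range N, cexp (2 * Real.pi * I * ((x * t : ℤ) : ℂ) / N) =
      if (N : ℤ) ∣ x then (N : ℂ) else 0 := by
  classical
  have h := AddChar.sum_mulShift (x : ZMod N) (ZMod.isPrimitive_stdAddChar N) (R' := ℂ)
  rw [ZMod.card, sum_zmod_eq_sum_range] at h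
  have hterm : ∀ t : ℕ, cexp (2 * Real.pi * I * ((x * t : ℤ) : ℂ) / N) =
      (ZMod.stdAddChar (((t : ℕ) : ZMod N) * (x : ZMod N)) : ℂ) := by
    intro t
    rw [← ZMod.stdAddChar_coe, Int.cast_mul, Int.cast_natCast, mul_comm]
  simp_rw [hterm]
  rw [h]
  by_cases hx : (N : ℤ) ∣ x
  · rw [if_pos hx, if_pos ((ZMod.intCast_zmod_eq_zero_iff_dvd x N).mpr hx)]
  · rw [if_neg hx, if_neg (fun h' ↦ hx ((ZMod.intCast_zmod_eq_zero_iff_dvd x N).mp h')),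
      Nat.cast_zero]

section PrimePow

variable {p : ℕ} [hp : Fact p.Prime]

/-- **`G(a; p^{e+2}) = p G(a; p^e)` for an odd prime `p ∤ a`.** Write `r = s + p^{e+1} t`
(`s < p^{e+1}`, `t < p`): `e(a r²/p^{e+2}) = e(a s²/p^{e+2}) e(2 a s t/p)`, and the sum over `t` is
`p · 𝟙[p ∣ s]`; for `s = p v`, `e(a s²/p^{e+2}) = e(a v²/p^e)`. [folklore] -/
theorem quadGaussSum_prime_pow_add_two (hp2 : p ≠ 2) (e : ℕ) {a : ℤ} (ha : ¬ (p : ℤ) ∣ a) :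
    quadGaussSum (p ^ (e + 2)) a 0 = p * quadGaussSum (p ^ e) a 0 := by
  have hp' := hp.out
  have hp0 : (p : ℂ) ≠ 0 := Nat.cast_ne_zero.mpr hp'.ne_zero
  have hpe : ((p ^ e : ℕ) : ℂ) ≠ 0 := by exact_mod_cast pow_ne_zero e hp'.ne_zero
  rw [quadGaussSum_zero_eq_sum_range, quadGaussSum_zero_eq_sum_range]
  -- `r = s + p^{e+1} t`
  have hr : range (p ^ (e + 2)) = range (p ^ (e + 1) * p) := by rw [← pow_succ]
  rw [hr, sum_range_mul_eq_sum_sum]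
  have hinner : ∀ s : ℕ, ∑ t ∈ range p,
      cexp (2 * Real.pi * I * ((a * (s + p ^ (e + 1) * t : ℕ) ^ 2 : ℤ) : ℂ) / (p ^ (e + 2) : ℕ)) =
      cexp (2 * Real.pi * I * ((a * s ^ 2 : ℤ) : ℂ) / (p ^ (e + 2) : ℕ)) *
        if (p : ℤ) ∣ 2 * a * s then (p : ℂ) else 0 := by
    intro s
    rw [← sum_range_cexp_mul_div p (2 * a * s), Finset.mul_sum]
    refine Finset.sum_congr rfl fun t _ ↦ ?_
    rw [← Complex.exp_add]
    refine cexp_eq_cexp_of_sub_eq (a * t ^ 2 * p ^ e) ?_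
    push_cast
    field_simp
    ring
  simp_rw [hinner]
  -- `p ∣ 2 a s ↔ p ∣ s`
  have hdvd : ∀ s : ℕ, (p : ℤ) ∣ 2 * a * s ↔ p ∣ s := by
    intro s
    have hpp : Prime (p : ℤ) := Nat.prime_iff_prime_int.mp hp'
    rw [hpp.dvd_mul, hpp.dvd_mul, Int.natCast_dvd_natCast]
    constructor
    · rintro ((h2 | h) | h)
      · exfalso
        have : (p : ℤ) ∣ (2 : ℕ) := by exact_mod_cast h2
        rw [Int.natCast_dvd_natCast, Nat.prime_dvd_prime_iff_eq hp' Nat.prime_two] at this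
        exact hp2 this
      · exact absurd h ha
      · exact h
    · exact fun h ↦ Or.inr h
  simp_rw [hdvd]
  -- `s = u + p v`, only `u = 0` survives
  obtain ⟨q, hq⟩ : ∃ q, p = q + 1 := ⟨p - 1, by have := hp'.one_lt; omega⟩
  have hr' : range (p ^ (e + 1)) = range (p * p ^ e) := by rw [← pow_succ']
  have hrq : range p = range (q + 1) := by rw [hq]
  rw [hr', sum_range_mul_eq_sum_sum, hrq, Finset.sum_range_succ', Finset.mul_sum]
  have hvan : ∑ w ∈ range q, ∑ v ∈ range (p ^ e),
      (cexp (2 * Real.pi * I * ((a * (w + 1 + p * v : ℕ) ^ 2 : ℤ) : ℂ) / (p ^ (e + 2) : ℕ)) *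
        if p ∣ w + 1 + p * v then (p : ℂ) else 0) = 0 := by
    refine Finset.sum_eq_zero fun w hw ↦ Finset.sum_eq_zero fun v _ ↦ ?_
    rw [Finset.mem_range] at hw
    have : ¬ p ∣ w + 1 + p * v := by
      rw [Nat.dvd_add_left (dvd_mul_right p v)]
      exact fun h ↦ by have := Nat.le_of_dvd (Nat.succ_pos w) h; omega
    rw [if_neg this, mul_zero]
  rw [hvan, zero_add]
  refine Finset.sum_congr rfl fun v _ ↦ ?_
  rw [if_pos ⟨v, by ring⟩, mul_comm]
  congr 1
  refine cexp_eq_cexp_of_sub_eq 0 ?_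
  push_cast
  field_simp
  ring

/-- `G(a, k; c) = 1` for `c = 1` (the one-point sum). [folklore] -/
theorem quadGaussSum_eq_one_of_eq_one {c : ℕ} [NeZero c] (hc : c = 1) (a k : ZMod c) :
    quadGaussSum c a k = 1 := by
  subst hc
  rw [quadGaussSum_def]
  have : ∀ x : ZMod 1, (ZMod.stdAddChar (a * x ^ 2 + k * x) : ℂ) = 1 := fun x ↦ by
    rw [Subsingleton.elim (a * x ^ 2 + k * x) 0, AddChar.map_zero_eq_one]
  simp_rw [this]
  rw [Finset.sum_const, Finset.card_univ, ZMod.card, one_nsmul]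

/-- **`G(a; p^k) = (a/p^k) G(1; p^k)` for an odd prime `p ∤ a`** (Jacobi symbol; induction on
`k` in steps of two). [folklore] -/
theorem quadGaussSum_prime_pow_eq (hp2 : p ≠ 2) {a : ℤ} (ha : ¬ (p : ℤ) ∣ a) (k : ℕ) :
    quadGaussSum (p ^ k) a 0 = jacobiSym a (p ^ k) * quadGaussSum (p ^ k) 1 0 := by
  have hp' := hp.out
  have h1 : ¬ (p : ℤ) ∣ 1 := by
    rw [Int.natCast_dvd]; simp [hp'.one_lt.ne']
  induction k using Nat.twoStepInduction with
  | zero =>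
    rw [quadGaussSum_eq_one_of_eq_one (pow_zero p), quadGaussSum_eq_one_of_eq_one (pow_zero p),
      pow_zero, jacobiSym.one_right, Int.cast_one, one_mul]
  | one =>
    rw [jacobiSym.pow_right, pow_one (jacobiSym a p), ← jacobiSym.legendreSym.to_jacobiSym]
    refine quadGaussSum_prime_eq' (pow_one p) hp2 ?_
    rwa [Ne, ZMod.intCast_zmod_eq_zero_iff_dvd]
  | more k ih0 _ =>
    have hgcd : a.gcd p = 1 :=
      Int.isCoprime_iff_gcd_eq_one.mp
        (((Nat.prime_iff_prime_int.mp hp').coprime_iff_not_dvd.mpr ha).symm)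
    have hJ : jacobiSym a (p ^ (k + 2)) = jacobiSym a (p ^ k) := by
      rw [pow_add, jacobiSym.mul_right' a (pow_ne_zero k hp'.ne_zero) (pow_ne_zero 2 hp'.ne_zero),
        jacobiSym.pow_right a p 2, jacobiSym.sq_one hgcd, mul_one]
    have hone : quadGaussSum (p ^ (k + 2)) 1 0 = p * quadGaussSum (p ^ k) 1 0 := by
      have := quadGaussSum_prime_pow_add_two hp2 k h1
      simpa using this
    rw [quadGaussSum_prime_pow_add_two hp2 k ha, hone, ih0, hJ]
    ring

end PrimePow

/-! ### Odd moduli: `G(a; n) = (a/n) G(1; n)` -/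

/-- **`G(a; n) = (a/n) G(1; n)` for odd `n ≥ 1` and `gcd(a, n) = 1`**, `(a/n)` the Jacobi symbol:
induction over the factorisation of `n` into coprime prime powers, using
`quadGaussSum_prime_pow_eq` and the multiplicativity `G(a; m₁m₂) = G(m₂ a; m₁) G(m₁ a; m₂)`
(so that `G(a; m₁m₂)/G(1; m₁m₂) = (m₂a/m₁)(m₁a/m₂)/((m₂/m₁)(m₁/m₂)) = (a/m₁m₂)`). [folklore] -/
theorem quadGaussSum_eq_jacobiSym_mul {n : ℕ} [NeZero n] (hn : Odd n) {a : ℤ}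
    (ha : a.gcd n = 1) : quadGaussSum n a 0 = jacobiSym a n * quadGaussSum n 1 0 := by
  suffices key : ∀ n : ℕ, ∀ hn0 : n ≠ 0, Odd n → ∀ a : ℤ, a.gcd n = 1 →
      @quadGaussSum n ⟨hn0⟩ (a : ZMod n) 0 = jacobiSym a n * @quadGaussSum n ⟨hn0⟩ 1 0 from
    key n (NeZero.ne n) hn a ha
  intro n
  induction n using Nat.recOnPosPrimePosCoprime with
  | zero => intro h0; exact absurd rfl h0
  | one =>
    intro _ _ a _
    rw [quadGaussSum_eq_one_of_eq_one rfl, quadGaussSum_eq_one_of_eq_one rfl,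
      jacobiSym.one_right, Int.cast_one, one_mul]
  | prime_pow p k hp hk =>
    intro h0 hodd a ha
    have hp' : p.Prime := hp
    haveI := Fact.mk hp'
    have hp2 : p ≠ 2 := by
      rintro rfl
      exact (Nat.not_even_iff_odd.mpr hodd) (Nat.even_pow.mpr ⟨even_two, hk.ne'⟩)
    have hpa : ¬ (p : ℤ) ∣ a := by
      have h1 : IsCoprime a ((p : ℤ) ^ k) := by
        have := Int.isCoprime_iff_gcd_eq_one.mpr ha
        exact_mod_cast this
      rw [IsCoprime.pow_right_iff hk] at h1
      exact (Nat.prime_iff_prime_int.mp hp').coprime_iff_not_dvd.mp h1.symm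
    exact quadGaussSum_prime_pow_eq hp2 hpa k
  | coprime m₁ m₂ hm₁ hm₂ hc ih₁ ih₂ =>
    intro h0 hodd a ha
    haveI : NeZero m₁ := ⟨by omega⟩
    haveI : NeZero m₂ := ⟨by omega⟩
    haveI : NeZero (m₁ * m₂) := ⟨h0⟩
    obtain ⟨ho₁, ho₂⟩ := Nat.odd_mul.mp hodd
    have h12 : IsCoprime (m₁ : ℤ) (m₂ : ℤ) := Nat.isCoprime_iff_coprime.mpr hc
    have hA : IsCoprime a ((m₁ : ℤ) * m₂) := by
      have := Int.isCoprime_iff_gcd_eq_one.mpr ha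
      exact_mod_cast this
    have g1 : ((m₂ : ℤ) * a).gcd m₁ = 1 :=
      Int.isCoprime_iff_gcd_eq_one.mp (h12.symm.mul_left hA.of_mul_right_left)
    have g2 : ((m₁ : ℤ) * a).gcd m₂ = 1 :=
      Int.isCoprime_iff_gcd_eq_one.mp (h12.mul_left hA.of_mul_right_right)
    have g3 : (m₂ : ℤ).gcd m₁ = 1 := Int.isCoprime_iff_gcd_eq_one.mp h12.symm
    have g4 : (m₁ : ℤ).gcd m₂ = 1 := Int.isCoprime_iff_gcd_eq_one.mp h12
    have e1 : ((1 : ZMod (m₁ * m₂))) = ((1 : ℤ) : ZMod (m₁ * m₂)) := by simp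
    rw [quadGaussSum_mul_of_coprime hc a, e1, quadGaussSum_mul_of_coprime hc 1]
    simp only [mul_one]
    rw [ih₁ (NeZero.ne m₁) ho₁ _ g1, ih₂ (NeZero.ne m₂) ho₂ _ g2, ih₁ (NeZero.ne m₁) ho₁ _ g3,
      ih₂ (NeZero.ne m₂) ho₂ _ g4, jacobiSym.mul_left, jacobiSym.mul_left,
      jacobiSym.mul_right' a (NeZero.ne m₁) (NeZero.ne m₂)]
    push_cast
    ring

/-- **`G(2a; n) = (2/n) G(a; n) = χ₈(n) G(a; n)` for odd `n` and `gcd(a, n) = 1`** — the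
odd-modulus input of `θ(2γz) θ(z) = χ₈(d) θ(γz) θ(2z)` on `Γ₀(8)`. [folklore] -/
theorem quadGaussSum_two_mul_left {n : ℕ} [NeZero n] (hn : Odd n) {a : ℤ} (ha : a.gcd n = 1) :
    quadGaussSum n ((2 * a : ℤ) : ZMod n) 0 = ZMod.χ₈ n * quadGaussSum n a 0 := by
  have h2 : (2 * a : ℤ).gcd n = 1 := by
    have h2n : IsCoprime (2 : ℤ) n := by
      rw [Int.isCoprime_iff_gcd_eq_one]
      exact_mod_cast Nat.coprime_two_left.mpr hn
    exact Int.isCoprime_iff_gcd_eq_one.mp (h2n.mul_left (Int.isCoprime_iff_gcd_eq_one.mpr ha))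
  rw [quadGaussSum_eq_jacobiSym_mul hn h2, quadGaussSum_eq_jacobiSym_mul hn ha,
    jacobiSym.mul_left, ← jacobiSym.at_two hn]
  push_cast
  ring

end Literature.NumberTheory.EllipticCurves.ModularForms
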